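import Summits.BirchSwinnertonDyer.Rank1Residual.X11b.Three.KolyvaginClassBadPlace
import HarnessLib

/-!
# T1 JET (cell `bsd-jet`), road K, K-GAP-2 (`h49str`), step (C1): Gross's bad-place mechanism
# UPGRADED from the Selmer condition to the STRINGENT Kummer condition — `res_v c(P) = δ_v(t)` with
# `t` read in a receptacle `B ≤ E(K̄_v)`

HONEST FRAMING (programme file §HONESTY, verbatim): «no tranche here proves BSD; ARM L moves the
LITERAL column of an r ≤ 1 census into the kernel-proved-modulo-named-print column.» THEOREMS ONLY
(seat `bsd-jet-pv-1`, session g7; `--supports stmt-BirchSwinnertonDyer-14418`, helper); 0 classes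
move. WHAT THIS IS. x11b3-p1's `GrossBadPlace.kolyvaginClass_mem_selmerLocalKer_of_inertia_of_zsmul_mem`
(Gross 1991 Prop. 6.2 (1) at a bad place: Kolyvagin's class `c(P)` dies in `H¹(K_v, E)`) takes as
input (α) "every `B`-valued unramified continuous crossed homomorphism `Γ_{K_v} → E(K̄_v)` has
trivial class". Jetchev's Prop. 4.9 (= printed Prop. 4.1, the STRINGENT condition
`loc_v κ ∈ δ_v(E⁰(K_v))`, [cite: Jetchev2008, Prop. 4.1 (p. 819)]) needs the same input in its
STRONG form — the coboundary is witnessed by a point OF `B` ("`H¹(K_v^{ur}/K_v, E⁰(K_v^{ur})) = 0`",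
Lang's theorem, the witness in `E⁰`) — and one more line of bookkeeping, which this file proves:

* `exists_localKummerMap_eq_zsmul_res_kolyvaginClass` — with `S ∈ B` the witness for the cocycle
  `σ ↦ n′·((σ−1)P/n)_v` and `Q' := n′·Q_v + S` (`nQ = P`): `n • Q' = n′·P_v + n·S` is `Γ_{K_v}`-fixed,
  equal to `e(t)` for an `E`-rational `t` with `e(t) ∈ B` (because `n′·P_v ∈ B`), and
  `δ_v(t) = n′ · res_v c(P)` (pointwise equality of cocycles);
* `exists_localKummerMap_eq_res_kolyvaginClass` — dividing by `n′` (`n′` prime to `n`, `n·c(P) = 0`):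
  **`res_v c(P) = δ_v(t)` for some `t ∈ E(K_v)` whose image in `E(K̄_v)` lies in `B`.**

With `B = E⁰(K̄_v)` (`X11b.E0Receptacle`) and `E⁰(K̄_v) ∩ E(K_v) = E₀(K_v)` this is
`loc_v c(P) ∈ H¹_{Kum⁰}(K_v, E[n])`; the inputs are exactly those of x11b3's END FORM plus `n′·P_v ∈ B`
(also from [GZ86 III (3.1)]) — uniformly in `v ∣ p` or `v ∤ p` (no Lemma 4.3).
References: [cite: Jetchev2008, Prop. 4.1 (pp. 819–821), Def. 4.8, Prop. 4.9 (arXiv numbering)]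
[cite: GrossLMS1991, Prop. 6.2 (1), pp. 244–245] [cite: McCallumLMS1991, Lemma 4.1, Cor. 4.2, Lemma 4.3]
[cite: MilneADT2006, Ch. I Prop. 3.8] [cite: SilvermanAEC2009, VIII.§2, X.§4 diagram (**)].
-/

set_option autoImplicit false

noncomputable section

open scoped Classical
open scoped AddSubgroup

namespace Summit.BirchSwinnertonDyer.Rank1Residual.JET.Stringent

open WeierstrassCurve NumberField IsDedekindDomain Field
  Literature.NumberTheory.EllipticCurves Literature.NumberTheory.EllipticCurves.KolyvaginCocycle
  Literature.NumberTheory.GaloisRepresentations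
  Summit.BirchSwinnertonDyer.Rank1Residual.X11b.Three.GrossBadPlace

universe u

variable {K : Type u} [Field K] [NumberField K] (W : WeierstrassCurve K) [W.IsElliptic] {n : ℤ}
variable {hdiv : ∀ P : geomPoints W, ∃ Q : geomPoints W, n • Q = P}
variable {A : AddSubgroup (geomPoints W)}
variable (E : Type u) [Field E] [Algebra K E] [CharZero E]

/-- **Gross's bad-place mechanism with the coboundary witness kept — `δ_v(t) = n′ · res_v c(P)`.**
`E/K` over a number field, `c(P)` Kolyvagin's class of `P ∈ A` (`A ⊆ E(K̄)` admissible, printed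
`A = E(K_c)`, `P = P_c`, `n = p^M`), `E` a `K`-field (a completion `K_v`) with a set `I ⊆ Γ_E`
fixing `P` (inertia; `K_c/K` unramified at `v`), a subgroup `B ≤ E(K̄_v)` (printed `E⁰`) and `n′`
with: `n′·P_v ∈ B` and `n′·((σ−1)P/n)_v ∈ B` for all `σ` ([GZ86 III (3.1)] via Gross p. 245) and the
STRONG (α): every `B`-valued continuous crossed homomorphism vanishing on `I` is `∂S` for some
`S ∈ B`. Then there is `t ∈ E(E)` with `e(t) ∈ B` (`e : E(E) ↪ E(K̄_E)`) and `δ_E(t) = n′ · res_E c(P)`.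
[cite: Jetchev2008, Prop. 4.1 (pp. 819–821)] [cite: GrossLMS1991, Prop. 6.2 (1), pp. 244–245]
[cite: MilneADT2006, Ch. I Prop. 3.8] -/
theorem exists_localKummerMap_eq_zsmul_res_kolyvaginClass (hn : n ≠ 0)
    (hA : IsAdmissible (absoluteGaloisGroup K) A n) {P : geomPoints W}
    (hP : P ∈ invPoints (absoluteGaloisGroup K) A n)
    {I : Set (absoluteGaloisGroup E)} (hI : ∀ σ ∈ I, resGal (K := K) E σ • P = P)
    (B : AddSubgroup (localPoints W E)) {n' : ℤ}
    (hPB : n' • pointsMap W E P ∈ B)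
    (hval : ∀ σ : absoluteGaloisGroup E,
      n' • pointsMap W E (rootIn A n (resGal (K := K) E σ • P - P)) ∈ B)
    (hcob : ∀ f : contOneCocycles (discreteTopRep (absoluteGaloisGroup E) (localPoints W E)),
      (∀ σ, f.1 σ ∈ B) → (∀ σ ∈ I, f.1 σ = 0) → ∃ S ∈ B, ∀ σ, f.1 σ = σ • S - S) :
    ∃ t : (W.baseChange E).toAffine.Point,
      W.baseChangeGeomPointsEquiv E (toGeomPoints (W.baseChange E) t) ∈ B ∧
      W.localKummerMap E hn t =
        n' • galoisCohomology.res (W.torsionGaloisModule n) E 1 (kolyvaginClass W n hdiv hA P hP) := by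
  have hcont := continuous_smul_geomPoints W
  have hsz : ∀ (m : ℤ) (σ : absoluteGaloisGroup E) (X : localPoints W E), σ • (m • X) = m • σ • X :=
    fun m σ X ↦ map_zsmul (DistribSMul.toAddMonoidHom (localPoints W E) σ) m X
  -- the root `Q` of `P` defining the class
  have hQ : n • Classical.choose (hdiv P) = P := Classical.choose_spec (hdiv P)
  set Q := Classical.choose (hdiv P) with hQdef
  -- Step 1: the local cocycle `σ ↦ -((σ−1)P/n)_v`, scaled by `n′`, is `B`-valued and unramified
  set f₀ := contOneCocycles.pullback (resGal (K := K) E)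
      (resHomOfEquivariant (resGal (K := K) E) (pointsMap W E) (pointsMap_smul W E))
      (negRootCocycle hA hcont hP) with hf₀def
  have hf₀ : ∀ σ, f₀.1 σ = -pointsMap W E (rootIn A n (resGal (K := K) E σ • P - P)) := by
    intro σ
    rw [hf₀def, contOneCocycles.pullback_apply, negRootCocycle_apply]
    change pointsMap W E (-rootIn A n (resGal (K := K) E σ • P - P)) = _
    rw [map_neg]
  have hfB : ∀ σ, (n' • f₀).1 σ ∈ B := fun σ ↦ by
    change n' • f₀.1 σ ∈ B
    rw [hf₀, smul_neg]
    exact B.neg_mem (hval σ)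
  have hfI : ∀ σ ∈ I, (n' • f₀).1 σ = 0 := fun σ hσ ↦ by
    change n' • f₀.1 σ = 0
    rw [hf₀, hI σ hσ, sub_self, rootIn_zero hA.eq_zero_of_zsmul, map_zero, neg_zero, smul_zero]
  obtain ⟨S₀, hS₀B, hS₀⟩ := hcob (n' • f₀) hfB hfI
  have hS₀' : ∀ σ : absoluteGaloisGroup E,
      σ • S₀ - S₀ = -(n' • pointsMap W E (rootIn A n (resGal (K := K) E σ • P - P))) := by
    intro σ
    rw [← hS₀ σ]
    change n' • f₀.1 σ = _
    rw [hf₀, smul_neg]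
  -- `σ P_v - P_v = n • ((σ−1)P/n)_v`
  have hroot : ∀ σ : absoluteGaloisGroup E, σ • pointsMap W E P - pointsMap W E P =
      n • pointsMap W E (rootIn A n (resGal (K := K) E σ • P - P)) := fun σ ↦ by
    rw [← pointsMap_smul, ← map_sub, ← map_zsmul, (rootIn_smul_sub_spec hP _).2]
  -- Step 2: `Q' := n′ Q_v + S₀`; `n Q' = n′ P_v + n S₀` is `Γ_E`-fixed
  set Q' : localPoints W E := n' • pointsMap W E Q + S₀ with hQ'def
  have hnQ' : n • Q' = n' • pointsMap W E P + n • S₀ := by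
    rw [hQ'def, zsmul_add, smul_smul, mul_comm, ← smul_smul, ← map_zsmul, hQ]
  have hQ'fix : n • Q' ∈ MulAction.fixedPoints (absoluteGaloisGroup E) (localPoints W E) := by
    intro σ
    rw [hnQ', smul_add, hsz, hsz, eq_add_of_sub_eq' (hroot σ), eq_add_of_sub_eq' (hS₀' σ)]
    module
  -- Step 3: `n Q' = e(t)` for an `E`-rational `t`
  have hfix' : (W.baseChangeGeomPointsEquiv E).symm (n • Q') ∈
      MulAction.fixedPoints (absoluteGaloisGroup E) (geomPoints (W.baseChange E)) := fun σ ↦ by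
    rw [← baseChangeGeomPointsEquiv_symm_smul, hQ'fix σ]
  obtain ⟨t, ht⟩ := (mem_range_toGeomPoints_iff (W.baseChange E) _).mpr hfix'
  refine ⟨t, ?_, ?_⟩
  · -- `e(t) = n′ P_v + n S₀ ∈ B`
    rw [ht, AddEquiv.apply_symm_apply, hnQ']
    exact B.add_mem hPB (B.zsmul_mem hS₀B n)
  -- Step 4: `δ_E(t) = κ_E(Q')` and `κ_E(Q') = n′ · res_E c(P)` (pointwise on cocycles)
  rw [W.localKummerMap_eq_localKummerClass E hn t Q' hQ'fix (by rw [ht, AddEquiv.apply_symm_apply])]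
  unfold kolyvaginClass cls WeierstrassCurve.localKummerClass
  rw [res_torsionGaloisModule_oneCocycleClass]
  -- `n′ • [ψ] = [n′ • ψ]` (linearity of the class map, up to the definitional coercions)
  refine Eq.trans ?_ (map_zsmul (oneCocycleClassₗ _) n' _)
  rw [oneCocycleClassₗ_apply]
  congr 1
  apply Subtype.ext
  ext σ : 1
  apply (W.torsionPointsEquiv n (E := E) hn).injective
  apply Subtype.ext
  change pointsMap W E ((W.localKummerCocycle n hn Q' hQ'fix).1 σ : geomTorsion W n) =
    pointsMap W E (((n' • (cocycle hA hcont hP (Classical.choose_spec (hdiv P))).1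
      (absGaloisRestrict K E σ) : geomTorsion W n) : geomPoints W))
  rw [pointsMap_localKummerCocycle_apply, AddSubgroupClass.coe_zsmul, map_zsmul, coe_cocycle_apply,
    map_sub, map_sub, ← resGal_eq_absGaloisRestrict, pointsMap_smul, ← hQdef, hQ'def, smul_add, hsz,
    eq_add_of_sub_eq' (hS₀' σ)]
  generalize σ • pointsMap W E Q = Y
  module

/-- **Gross 1991 Prop. 6.2 (1) ⇒ Jetchev 2008 Prop. 4.1 mechanism: `res_E c(P) = δ_E(t)` with
`e(t) ∈ B`.** Same setting; in addition `n′` is prime to `n`. Since `n · c(P) = 0`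
(`GrossBadPlace.zsmul_cls_eq_zero`), `res_E c(P) = b · n′ · res_E c(P) = δ_E(b·t)` for `a n + b n′ = 1`,
and `e(b·t) = b·e(t) ∈ B`. With `B = E⁰(K̄_v)`, `E⁰(K̄_v) ∩ E(K_v) = E₀(K_v)`: this is
`loc_v c(P) ∈ δ_v(E₀(K_v)) = H¹_{Kum⁰}(K_v, E[n])`, the stringent condition.
[cite: Jetchev2008, Prop. 4.1 (pp. 819–821), Def. 4.8] [cite: GrossLMS1991, Prop. 6.2 (1)]
[cite: MilneADT2006, Ch. I Prop. 3.8] -/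
theorem exists_localKummerMap_eq_res_kolyvaginClass (hn : n ≠ 0)
    (hA : IsAdmissible (absoluteGaloisGroup K) A n) {P : geomPoints W}
    (hP : P ∈ invPoints (absoluteGaloisGroup K) A n)
    {I : Set (absoluteGaloisGroup E)} (hI : ∀ σ ∈ I, resGal (K := K) E σ • P = P)
    (B : AddSubgroup (localPoints W E)) {n' : ℤ} (hcop : IsCoprime n n')
    (hPB : n' • pointsMap W E P ∈ B)
    (hval : ∀ σ : absoluteGaloisGroup E,
      n' • pointsMap W E (rootIn A n (resGal (K := K) E σ • P - P)) ∈ B)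
    (hcob : ∀ f : contOneCocycles (discreteTopRep (absoluteGaloisGroup E) (localPoints W E)),
      (∀ σ, f.1 σ ∈ B) → (∀ σ ∈ I, f.1 σ = 0) → ∃ S ∈ B, ∀ σ, f.1 σ = σ • S - S) :
    ∃ t : (W.baseChange E).toAffine.Point,
      W.baseChangeGeomPointsEquiv E (toGeomPoints (W.baseChange E) t) ∈ B ∧
      W.localKummerMap E hn t =
        galoisCohomology.res (W.torsionGaloisModule n) E 1 (kolyvaginClass W n hdiv hA P hP) := by
  obtain ⟨t, htB, ht⟩ :=
    exists_localKummerMap_eq_zsmul_res_kolyvaginClass W E hn hA hP hI B hPB hval hcob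
  obtain ⟨a, b, hab⟩ := hcop
  refine ⟨b • t, ?_, ?_⟩
  · rw [map_zsmul, map_zsmul]
    exact B.zsmul_mem htB b
  · -- `n • c(P) = 0`
    have hc0 : n • kolyvaginClass W n hdiv hA P hP = 0 :=
      zsmul_cls_eq_zero hA (continuous_smul_geomPoints W) hP _
    have hn0 : n • galoisCohomology.res (W.torsionGaloisModule n) E 1
        (kolyvaginClass W n hdiv hA P hP) = 0 := by
      rw [← map_zsmul]
      exact (congrArg (galoisCohomology.res (W.torsionGaloisModule n) E 1) hc0).trans (map_zero _)
    rw [map_zsmul, ht, smul_smul]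
    set R := galoisCohomology.res (W.torsionGaloisModule n) E 1 (kolyvaginClass W n hdiv hA P hP)
    calc (b * n') • R = a • (n • R) + (b * n') • R := by rw [hn0, zsmul_zero, zero_add]
      _ = (a * n + b * n') • R := by rw [add_zsmul, mul_zsmul R a n]
      _ = R := by rw [hab, one_zsmul]

end Summit.BirchSwinnertonDyer.Rank1Residual.JET.Stringent

end
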